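import Summits.Ventures.WeilGRH.WindowBudgetGoldstonGonek
import HarnessLib

/-!
# GRH arm (rh-explicit, venture WeilGRH): THE ORDER OF `L(s, χ)` AT THE CENTRAL POINT IS
  `≤ (½ + o(1)) log q / log log q` UNDER GRH — the conductor aspect of the window budget

Cell `rh-explicit`, WEIL TRACK (structure seat weil-3, gen10).  Companion of `WindowBudgetGoldstonGonek.lean`
(there: the height aspect, `τ → ∞` at fixed `q`).  At the central point `τ = 0` the elementary budget of that
file reads `2a·ord_{s=½} L(s,χ) ≤ log q + (3 − log π + π) + 5/a + 8a·e^a` for every window `a > 0`; the same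
real-analysis step, made UNIFORM in the bounded quantity, gives the classical bound on the analytic rank at the
central point in the conductor aspect:

* `le_of_window_budget_uniform` (pure real analysis): for every `C` and `ε > 0`, for all large real `x`, EVERY
  `m ≥ 0` with `2a·m ≤ log x + C + 5/a + 8a·e^a` for all `a > 0` satisfies `m ≤ (½ + ε) log x / log log x`;
* **`centralOrder_le_of_grh_eventually`**: for every `ε > 0`, for all large moduli `q`, for every PRIMITIVE
  Dirichlet character `χ` mod `q` satisfying GRH: `ord_{s=½} L(s, χ) ≤ (½ + ε)·log q / log log q`
  — from Weil positivity of the twisted form at the single window `a = log log q − 2 log log log q`.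

No definitions, no named facts; GRH is a hypothesis.
-/

set_option autoImplicit false

noncomputable section

open Complex Filter Set MeasureTheory
open scoped Real Topology

namespace Summit.Ventures.WeilGRH

open Literature.NumberTheory.LFunctions

/-! ## The uniform real-analysis step -/

/-- The auxiliary ratio `(8L + C'u + 2(1+2ε)L·log u)/(L·u)`, `L = log x`, `u = log log x`, tends to `0`. -/
private theorem tendsto_central_aux (C' ε : ℝ) :
    Tendsto (fun x : ℝ ↦ (8 * Real.log x + C' * Real.log (Real.log x) +
        2 * (1 + 2 * ε) * Real.log x * Real.log (Real.log (Real.log x))) /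
        (Real.log x * Real.log (Real.log x))) atTop (𝓝 0) := by
  have TL : Tendsto (fun x : ℝ ↦ Real.log x) atTop atTop := Real.tendsto_log_atTop
  have Tu : Tendsto (fun x : ℝ ↦ Real.log (Real.log x)) atTop atTop := Real.tendsto_log_atTop.comp TL
  have T1 : Tendsto (fun x : ℝ ↦ 8 / Real.log (Real.log x)) atTop (𝓝 0) := tendsto_const_nhds.div_atTop Tu
  have T2 : Tendsto (fun x : ℝ ↦ C' / Real.log x) atTop (𝓝 0) := tendsto_const_nhds.div_atTop TL
  have T3 : Tendsto (fun x : ℝ ↦ Real.log (Real.log (Real.log x)) / Real.log (Real.log x)) atTop (𝓝 0) :=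
    (Real.isLittleO_log_id_atTop.tendsto_div_nhds_zero).comp Tu
  have T := T1.add (T2.add (T3.const_mul (2 * (1 + 2 * ε))))
  simp only [add_zero, mul_zero] at T
  refine T.congr' ?_
  filter_upwards [TL.eventually_gt_atTop 0, Tu.eventually_gt_atTop 0] with x hL hu
  field_simp
  ring

/-- **Uniform budget-to-bound step** (pure real analysis): for every `C`, `ε > 0`, eventually in `x`, EVERY
`m ≥ 0` with `2a·m ≤ log x + C + 5/a + 8a·e^a` for all `a > 0` satisfies `m ≤ (½ + ε)·log x / log log x`. -/
theorem le_of_window_budget_uniform (C : ℝ) {ε : ℝ} (hε : 0 < ε) :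
    ∀ᶠ x : ℝ in atTop, ∀ m : ℝ, 0 ≤ m →
      (∀ a : ℝ, 0 < a → 2 * a * m ≤ Real.log x + C + 5 / a + 8 * a * Real.exp a) →
        m ≤ (1 / 2 + ε) * Real.log x / Real.log (Real.log x) := by
  have TL : Tendsto (fun x : ℝ ↦ Real.log x) atTop atTop := Real.tendsto_log_atTop
  have Tu : Tendsto (fun x : ℝ ↦ Real.log (Real.log x)) atTop atTop := Real.tendsto_log_atTop.comp TL
  have T3 : Tendsto (fun x : ℝ ↦ Real.log (Real.log (Real.log x)) / Real.log (Real.log x)) atTop (𝓝 0) :=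
    (Real.isLittleO_log_id_atTop.tendsto_div_nhds_zero).comp Tu
  have hε2 : (0 : ℝ) < 2 * ε := by positivity
  filter_upwards [eventually_ge_atTop (1 : ℝ), Tu.eventually_ge_atTop 4,
    (tendsto_order.1 T3).2 (1 / 4) (by norm_num), (tendsto_order.1 (tendsto_central_aux (C + 5) ε)).2 (2 * ε) hε2]
    with x hx1 hu4 hlu hg m hm0 h
  set L : ℝ := Real.log x with hL
  set u : ℝ := Real.log L with hu
  have hL0' : 0 ≤ L := Real.log_nonneg hx1
  have hL0 : 0 < L := by
    rcases hL0'.eq_or_lt with h0 | h0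
    · exfalso
      have : u = 0 := by rw [hu, ← h0, Real.log_zero]
      linarith
    · exact h0
  have hu0 : 0 < u := by linarith
  have hlogu0 : 0 ≤ Real.log u := Real.log_nonneg (by linarith)
  have hlogu : Real.log u ≤ u / 4 := by
    have h' := hlu.le
    rwa [div_le_iff₀ hu0, show (1:ℝ) / 4 * u = u / 4 by ring] at h'
  set a : ℝ := u - 2 * Real.log u with ha
  have hau : a ≤ u := by linarith
  have ha1 : 1 ≤ a := by linarith
  have ha0 : 0 < a := by linarith
  have hexpu : Real.exp u = L := by rw [hu, Real.exp_log hL0]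
  have hexp2 : Real.exp (2 * Real.log u) = u ^ 2 := by
    rw [show 2 * Real.log u = Real.log u + Real.log u by ring, Real.exp_add, Real.exp_log hu0, sq]
  have hexp : Real.exp a = L / u ^ 2 := by rw [ha, Real.exp_sub, hexpu, hexp2]
  have h0 := h a ha0
  have h5 : 5 / a ≤ 5 := by
    rw [div_le_iff₀ ha0]; linarith
  have h8 : 8 * a * Real.exp a ≤ 8 * L / u := by
    rw [hexp, le_div_iff₀ hu0]
    have e : 8 * a * (L / u ^ 2) * u = 8 * L * (a / u) := by field_simp
    rw [e]
    exact mul_le_of_le_one_right (by positivity) ((div_le_one hu0).2 hau)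
  have hR : 2 * a * m ≤ L + 8 * L / u + (C + 5) := by linarith
  have hkey : 8 * L + (C + 5) * u + 2 * (1 + 2 * ε) * L * Real.log u < 2 * ε * (L * u) := by
    have h' := hg
    rw [div_lt_iff₀ (by positivity)] at h'
    linarith
  rw [le_div_iff₀ hu0]
  have hm_le : m ≤ (L + 8 * L / u + (C + 5)) / (2 * a) := by
    rw [le_div_iff₀ (by positivity)]; linarith
  have e1 : (L + 8 * L / u + (C + 5)) * u = L * u + 8 * L + (C + 5) * u := by field_simp
  have e2 : (1 / 2 + ε) * L * (2 * a) = L * u + 2 * ε * (L * u) - 2 * (1 + 2 * ε) * L * Real.log u := by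
    rw [ha]; ring
  calc m * u ≤ (L + 8 * L / u + (C + 5)) / (2 * a) * u := mul_le_mul_of_nonneg_right hm_le hu0.le
    _ = (L * u + 8 * L + (C + 5) * u) / (2 * a) := by rw [div_mul_eq_mul_div, e1]
    _ ≤ (1 / 2 + ε) * L := by
        rw [div_le_iff₀ (by positivity), e2]
        linarith

/-! ## The central order of `L(s, χ)` in the conductor aspect -/

/-- **GRH ⟹ THE ANALYTIC RANK AT THE CENTRAL POINT IS `≤ (½ + o(1)) log q / log log q`.**  For every `ε > 0`,
for all large `q`: every primitive `χ` mod `q` satisfying GRH has `ord_{s=½} L(s, χ) ≤ (½ + ε)·log q / log log q`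
(from `two_mul_mul_charZeroOrder_le_explicit` at `τ = 0` — Weil positivity of the twisted form at the window
`a = log log q − 2 log log log q` — and `le_of_window_budget_uniform`). -/
theorem centralOrder_le_of_grh_eventually {ε : ℝ} (hε : 0 < ε) :
    ∀ᶠ q : ℕ in atTop, ∀ [NeZero q] (χ : DirichletCharacter ℂ q), χ.IsPrimitive → χ.RiemannHypothesis →
      (DirichletDisc.zeroOrder χ (1 / 2) : ℝ) ≤ (1 / 2 + ε) * Real.log q / Real.log (Real.log q) := by
  have hreal := le_of_window_budget_uniform (3 - Real.log π + π) hε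
  have hnat := (tendsto_natCast_atTop_atTop (R := ℝ)).eventually hreal
  filter_upwards [hnat, eventually_ge_atTop 2] with q hq hq2
  intro _ χ hprim hGRH
  have hq1 : q ≠ 1 := by omega
  refine hq _ (by positivity) fun a ha ↦ ?_
  have h := two_mul_mul_charZeroOrder_le_explicit hq1 hprim hGRH ha 0
  have e0 : (1 / 2 + ((0 : ℝ) : ℂ) * I : ℂ) = 1 / 2 := by simp
  rw [e0] at h
  simp only [abs_zero, add_zero, Real.log_one, zero_add] at h
  linarith

end Summit.Ventures.WeilGRH

end
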